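import Summits.AtomisticToContinuum.Crystallization.Theorems.FreeSplittingCertificatesStrictSplittingRuleP1TransferRec

/-!
# `StrictSplittingRule` (stmt-AtomisticToContinuum-12560): the cube form REGROUPED BOND BY BOND — matched TABLE WEIGHTS of the receipts transfer (P1 interpolant object, part 16)

Route `FreeSplittingCertificates`, crux r3 `StrictSplittingRule` (H12⋆ = `stub_coreJointCoercive`), unit b2b-freesplit-B gen 22.
VALUE = the combinatorial half of item (2'') (HOME FAR-LEMMA-SPEC §7 (k), §16 (c)): the lattice receipts form `Σ'_n p1CubeRec W n` of the
transfer theorem `integral_fpRec_le_tsum_p1CubeRec` (part 15) is a sum over CUBES of the chart; H12⋆'s second-order tables are indexed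
by (tail site, bond offset).  Here the sum is regrouped bond by bond:
`Σ'_n p1CubeRec W n = Σ'_q Σ_{d ∈ p1BondOffsets} p1BondW W q d · str(q, q+d)²`
with the explicit, finitely supported (in `d`), cube-local MATCHED WEIGHT `p1BondW W q d` = Σ over the ≤ 8 cubes `q − o` cornering at `q`
of the sharp element constants (4 per corner tetrahedron, 16 per octahedron with the max quarter weight) times the cell weights of the slots
whose edge is `q → q + d`.  Generic engine: `tsum_mul_sum_slots_eq` (translation reindexing `n = q − o` per corner, finite/infinite sum
swaps for nonnegative summable families).  With part 15: `a⁴·∫χ²Den(∇ṽ) ≤ Σ'_q Σ_d p1BondW W q d · str(q,q+d)²` — the receipts the far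
inequality needs at a site are a DIAGONAL quadratic form in the lattice stretches around it, i.e. of the shape of the (antisymmetrised,
diagonal) second-order transfer tables of `CoreJointSiteIneq`.  Remaining for the assembler on this side: lattice-translation covariance
of the weights (a function of (parity of `q`, `p − q`, `d`)) and their `(1+r)⁻⁶` decay.  NOT a proof of H12⋆, NOT summit progress.  [folklore]
-/

noncomputable section

open Set Function Metric MeasureTheory Filter Topology
open scoped BigOperators NNReal ENNReal

namespace Summit.AtomisticToContinuum.Crystallization.Theorems.StrictSplittingRuleBirth

open Literature.MathematicalPhysics.StatisticalMechanics
open Summit.AtomisticToContinuum.Crystallization.Theorems.PalmUnimodularRigidity.LayeredLawsSelectHcp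

/-! ## Corners, bond offsets, slot weights -/

/-- The eight corner offsets of a cube of the chart. -/
def p1Corners : Finset (ℤ × ℤ × ℤ) :=
  {(0, 0, 0), (0, 0, 1), (0, 1, 0), (0, 1, 1), (1, 0, 0), (1, 0, 1), (1, 1, 0), (1, 1, 1)}

/-- The possible bond offsets `head − tail` of cube edges (differences of corners). -/
def p1BondOffsets : Finset (ℤ × ℤ × ℤ) :=
  (p1Corners ×ˢ p1Corners).image fun oo => oo.2 - oo.1

/-- Membership in the corner set: every coordinate is `0` or `1`. -/
theorem mem_p1Corners_iff (o : ℤ × ℤ × ℤ) :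
    o ∈ p1Corners ↔ (o.1 = 0 ∨ o.1 = 1) ∧ (o.2.1 = 0 ∨ o.2.1 = 1) ∧ (o.2.2 = 0 ∨ o.2.2 = 1) := by
  obtain ⟨k, i, j⟩ := o
  simp only [p1Corners, Finset.mem_insert, Finset.mem_singleton, Prod.mk.injEq]
  constructor
  · rintro (⟨h1, h2, h3⟩ | ⟨h1, h2, h3⟩ | ⟨h1, h2, h3⟩ | ⟨h1, h2, h3⟩ | ⟨h1, h2, h3⟩ | ⟨h1, h2, h3⟩ | ⟨h1, h2, h3⟩ | ⟨h1, h2, h3⟩) <;>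
      simp [h1, h2, h3]
  · rintro ⟨h1 | h1, h2 | h2, h3 | h3⟩ <;> simp [h1, h2, h3]

/-- Tetrahedron slot tails are corners. -/
theorem p1TetTail_mem (b : Bool) (p : Fin 2) (e : Fin 6) : p1TetTail b p e ∈ p1Corners :=
  (mem_p1Corners_iff _).2 (p1TetTail_corner b p e)

/-- Tetrahedron slot heads are corners. -/
theorem p1TetHead_mem (b : Bool) (p : Fin 2) (e : Fin 6) : p1TetHead b p e ∈ p1Corners :=
  (mem_p1Corners_iff _).2 (p1TetHead_corner b p e)

/-- Octahedron slot tails are corners. -/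
theorem p1OctTail_mem (b : Bool) (e : Fin 12) : p1OctTail b e ∈ p1Corners :=
  (mem_p1Corners_iff _).2 (p1OctTail_corner b e)

/-- Octahedron slot heads are corners. -/
theorem p1OctHead_mem (b : Bool) (e : Fin 12) : p1OctHead b e ∈ p1Corners :=
  (mem_p1Corners_iff _).2 (p1OctHead_corner b e)

/-- Differences of corners are bond offsets. -/
theorem sub_mem_p1BondOffsets {t e : ℤ × ℤ × ℤ} (ht : t ∈ p1Corners) (he : e ∈ p1Corners) : e - t ∈ p1BondOffsets :=
  Finset.mem_image.2 ⟨(t, e), Finset.mk_mem_product ht he, rfl⟩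

/-- **Slot weight** of the bond `q → q + d` for one slot family (tail/head tables `τ, η` by cube parity, cube coefficient `c`): the sum
over the cubes `q − o` cornering at `q` of the coefficients of the slots whose edge is exactly `q → q + d`. -/
def p1SlotW {ι : Type*} [Fintype ι] (τ η : Bool → ι → ℤ × ℤ × ℤ) (c : ℤ × ℤ × ℤ → ℝ) (q d : ℤ × ℤ × ℤ) : ℝ :=
  ∑ o ∈ p1Corners, ∑ i, if τ (p1Par (q - o)) i = o ∧ η (p1Par (q - o)) i = o + d then c (q - o) else 0

/-- **THE MATCHED TABLE WEIGHT** of the bond `q → q + d` for the cell weights `W`: corner tetrahedra (constant 4, weights `W(·,0)`,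
`W(·,1)`) and octahedra (constant 16, weight `p1OctW`) of the ≤ 8 cubes around `q` whose edge slots contain that bond. -/
def p1BondW (W : (ℤ × ℤ × ℤ) × Fin 6 → ℝ) (q d : ℤ × ℤ × ℤ) : ℝ :=
  p1SlotW (fun b => p1TetTail b 0) (fun b => p1TetHead b 0) (fun n => 4 * W (n, 0)) q d +
    p1SlotW (fun b => p1TetTail b 1) (fun b => p1TetHead b 1) (fun n => 4 * W (n, 1)) q d +
    p1SlotW p1OctTail p1OctHead (fun n => 16 * p1OctW W n) q d

/-! ## The regrouping engine -/

/-- Inserting the corner/offset of an edge: only `(o, d) = (t, e − t)` survives. -/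
theorem sum_sum_ite_tail_head {t e : ℤ × ℤ × ℤ} (ht : t ∈ p1Corners) (he : e ∈ p1Corners) (g : ℤ × ℤ × ℤ → ℤ × ℤ × ℤ → ℝ) :
    (∑ o ∈ p1Corners, ∑ d ∈ p1BondOffsets, if t = o ∧ e = o + d then g o d else 0) = g t (e - t) := by
  rw [Finset.sum_eq_single_of_mem t ht fun o _ hne => Finset.sum_eq_zero fun d _ => if_neg fun hc => hne hc.1.symm]
  rw [Finset.sum_eq_single_of_mem (e - t) (sub_mem_p1BondOffsets ht he) fun d _ hne =>
    if_neg fun hc => hne (by rw [hc.2]; exact (add_sub_cancel_left t d).symm)]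
  rw [if_pos ⟨rfl, (add_sub_cancel t e).symm⟩]

/-- **Regrouping engine**: for nonnegative cube coefficients `c`, a nonnegative pair function `S` and slot tables valued in corners,
`Σ'_n c(n)·Σ_i S(n + τ_i, n + η_i) = Σ'_q Σ_{d} p1SlotW τ η c q d · S(q, q + d)` (and the right-hand family is summable), provided the
left-hand family is summable.  (Slice each cube term by (corner, offset), reindex `n = q − o` per corner, swap finite and infinite sums.) -/
theorem tsum_mul_sum_slots_eq {ι : Type*} [Fintype ι] (τ η : Bool → ι → ℤ × ℤ × ℤ) (hτ : ∀ b i, τ b i ∈ p1Corners)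
    (hη : ∀ b i, η b i ∈ p1Corners) {c : ℤ × ℤ × ℤ → ℝ} (hc : ∀ n, 0 ≤ c n) {S : ℤ × ℤ × ℤ → ℤ × ℤ × ℤ → ℝ} (hS : ∀ q q', 0 ≤ S q q')
    (hs : Summable fun n => c n * ∑ i, S (n + τ (p1Par n) i) (n + η (p1Par n) i)) :
    Summable (fun q => ∑ d ∈ p1BondOffsets, p1SlotW τ η c q d * S q (q + d)) ∧
    ∑' n, c n * ∑ i, S (n + τ (p1Par n) i) (n + η (p1Par n) i) = ∑' q, ∑ d ∈ p1BondOffsets, p1SlotW τ η c q d * S q (q + d) := by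
  classical
  -- the (corner, offset)-sliced family
  set Φ : (ℤ × ℤ × ℤ) → (ℤ × ℤ × ℤ) → (ℤ × ℤ × ℤ) → ℝ := fun o d n =>
    ∑ i, if τ (p1Par n) i = o ∧ η (p1Par n) i = o + d then c n * S (n + o) (n + o + d) else 0 with hΦ
  have hΦ0 : ∀ o d n, 0 ≤ Φ o d n := fun o d n =>
    Finset.sum_nonneg fun i _ => by
      split_ifs
      · exact mul_nonneg (hc n) (hS _ _)
      · exact le_rfl
  -- slicing a cube term
  have hslice : ∀ n, (∑ o ∈ p1Corners, ∑ d ∈ p1BondOffsets, Φ o d n) = c n * ∑ i, S (n + τ (p1Par n) i) (n + η (p1Par n) i) := by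
    intro n
    calc (∑ o ∈ p1Corners, ∑ d ∈ p1BondOffsets, Φ o d n)
        = ∑ o ∈ p1Corners, ∑ i, ∑ d ∈ p1BondOffsets,
            (if τ (p1Par n) i = o ∧ η (p1Par n) i = o + d then c n * S (n + o) (n + o + d) else 0) :=
          Finset.sum_congr rfl fun o _ => Finset.sum_comm
      _ = ∑ i, ∑ o ∈ p1Corners, ∑ d ∈ p1BondOffsets,
            (if τ (p1Par n) i = o ∧ η (p1Par n) i = o + d then c n * S (n + o) (n + o + d) else 0) := Finset.sum_comm
      _ = ∑ i, c n * S (n + τ (p1Par n) i) (n + η (p1Par n) i) := by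
          refine Finset.sum_congr rfl fun i _ => ?_
          rw [sum_sum_ite_tail_head (hτ _ i) (hη _ i) (fun o d => c n * S (n + o) (n + o + d)), add_add_sub_cancel]
      _ = c n * ∑ i, S (n + τ (p1Par n) i) (n + η (p1Par n) i) := by rw [Finset.mul_sum]
  -- each slice is summable (nonnegative, dominated by the cube term)
  have hsum_od : ∀ o ∈ p1Corners, ∀ d ∈ p1BondOffsets, Summable (Φ o d) := fun o ho d hd =>
    Summable.of_nonneg_of_le (hΦ0 o d)
      (fun n => ((Finset.single_le_sum (fun d' _ => hΦ0 o d' n) hd).trans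
        (Finset.single_le_sum (f := fun o' => ∑ d' ∈ p1BondOffsets, Φ o' d' n)
          (fun o' _ => Finset.sum_nonneg fun d' _ => hΦ0 o' d' n) ho)).trans (hslice n).le) hs
  -- Step 1: the cube sum as a finite sum of sliced sums
  have step1 : ∑ o ∈ p1Corners, ∑ d ∈ p1BondOffsets, ∑' n, Φ o d n = ∑' n, c n * ∑ i, S (n + τ (p1Par n) i) (n + η (p1Par n) i) := by
    calc ∑ o ∈ p1Corners, ∑ d ∈ p1BondOffsets, ∑' n, Φ o d n
        = ∑ o ∈ p1Corners, ∑' n, ∑ d ∈ p1BondOffsets, Φ o d n :=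
          Finset.sum_congr rfl fun o ho => (Summable.tsum_finsetSum fun d hd => hsum_od o ho d hd).symm
      _ = ∑' n, ∑ o ∈ p1Corners, ∑ d ∈ p1BondOffsets, Φ o d n :=
          (Summable.tsum_finsetSum fun o ho => summable_sum fun d hd => hsum_od o ho d hd).symm
      _ = ∑' n, c n * ∑ i, S (n + τ (p1Par n) i) (n + η (p1Par n) i) := tsum_congr hslice
  -- Step 2: reindex each slice by the tail site `q = n + o`
  have step2 : ∀ o d, ∑' n, Φ o d n = ∑' q, Φ o d (q - o) := fun o d => by
    have e := (Equiv.subRight o).tsum_eq (Φ o d)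
    simp only [Equiv.subRight_apply] at e
    exact e.symm
  have step4 : ∀ o ∈ p1Corners, ∀ d ∈ p1BondOffsets, Summable fun q => Φ o d (q - o) := fun o ho d hd => by
    have e := (Equiv.subRight o).summable_iff (f := Φ o d)
    simp only [Function.comp_def, Equiv.subRight_apply] at e
    exact e.2 (hsum_od o ho d hd)
  -- Step 3: the reindexed slice, pointwise
  have step3 : ∀ o d q, Φ o d (q - o) =
      (∑ i, if τ (p1Par (q - o)) i = o ∧ η (p1Par (q - o)) i = o + d then c (q - o) else 0) * S q (q + d) := by
    intro o d q
    simp only [hΦ, sub_add_cancel]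
    rw [Finset.sum_mul]
    refine Finset.sum_congr rfl fun i _ => ?_
    split_ifs
    · rfl
    · rw [zero_mul]
  have hpt : ∀ q, (∑ d ∈ p1BondOffsets, p1SlotW τ η c q d * S q (q + d)) =
      ∑ o ∈ p1Corners, ∑ d ∈ p1BondOffsets, Φ o d (q - o) := by
    intro q
    rw [Finset.sum_comm]
    refine Finset.sum_congr rfl fun d _ => ?_
    unfold p1SlotW
    rw [Finset.sum_mul]
    exact Finset.sum_congr rfl fun o _ => (step3 o d q).symm
  have hsumR : Summable fun q => ∑ d ∈ p1BondOffsets, p1SlotW τ η c q d * S q (q + d) := by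
    refine (summable_sum fun o ho => summable_sum fun d hd => step4 o ho d hd).congr fun q => ?_
    exact (hpt q).symm
  refine ⟨hsumR, ?_⟩
  calc ∑' n, c n * ∑ i, S (n + τ (p1Par n) i) (n + η (p1Par n) i)
      = ∑ o ∈ p1Corners, ∑ d ∈ p1BondOffsets, ∑' n, Φ o d n := step1.symm
    _ = ∑ o ∈ p1Corners, ∑ d ∈ p1BondOffsets, ∑' q, Φ o d (q - o) :=
        Finset.sum_congr rfl fun o _ => Finset.sum_congr rfl fun d _ => step2 o d
    _ = ∑ o ∈ p1Corners, ∑' q, ∑ d ∈ p1BondOffsets, Φ o d (q - o) :=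
        Finset.sum_congr rfl fun o ho => (Summable.tsum_finsetSum fun d hd => step4 o ho d hd).symm
    _ = ∑' q, ∑ o ∈ p1Corners, ∑ d ∈ p1BondOffsets, Φ o d (q - o) :=
        (Summable.tsum_finsetSum fun o ho => summable_sum fun d hd => step4 o ho d hd).symm
    _ = ∑' q, ∑ d ∈ p1BondOffsets, p1SlotW τ η c q d * S q (q + d) := tsum_congr fun q => (hpt q).symm

/-! ## The cube form regrouped -/

/-- **THE CUBE FORM REGROUPED BOND BY BOND**: for nonnegative cell weights with summable cube form,
`Σ'_n p1CubeRec W n = Σ'_q Σ_{d ∈ p1BondOffsets} p1BondW W q d · str(q, q + d)²`, and the bond family is summable.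
NOT a proof of H12⋆, NOT summit progress. -/
theorem tsum_p1CubeRec_eq_tsum_bond (a h : ℝ) (U : ℤ × ℤ × ℤ → (Fin 3 → ℝ)) (b₀ : Fin 3 → ℝ) (A : Fin 3 → Fin 3 → ℝ)
    {W : (ℤ × ℤ × ℤ) × Fin 6 → ℝ} (hW : ∀ i, 0 ≤ W i) (hs : Summable (p1CubeRec a h U b₀ A W)) :
    Summable (fun q => ∑ d ∈ p1BondOffsets, p1BondW W q d * p1Str a h U b₀ A q (q + d) ^ 2) ∧
    ∑' n, p1CubeRec a h U b₀ A W n = ∑' q, ∑ d ∈ p1BondOffsets, p1BondW W q d * p1Str a h U b₀ A q (q + d) ^ 2 := by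
  set S : (ℤ × ℤ × ℤ) → (ℤ × ℤ × ℤ) → ℝ := fun q q' => p1Str a h U b₀ A q q' ^ 2 with hSdef
  have hS : ∀ q q', 0 ≤ S q q' := fun _ _ => sq_nonneg _
  set f0 : (ℤ × ℤ × ℤ) → ℝ := fun n => 4 * W (n, 0) * ∑ e : Fin 6, S (n + p1TetTail (p1Par n) 0 e) (n + p1TetHead (p1Par n) 0 e)
    with hf0
  set f1 : (ℤ × ℤ × ℤ) → ℝ := fun n => 4 * W (n, 1) * ∑ e : Fin 6, S (n + p1TetTail (p1Par n) 1 e) (n + p1TetHead (p1Par n) 1 e)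
    with hf1
  set f2 : (ℤ × ℤ × ℤ) → ℝ := fun n => 16 * p1OctW W n * ∑ e : Fin 12, S (n + p1OctTail (p1Par n) e) (n + p1OctHead (p1Par n) e)
    with hf2
  have hdec : ∀ n, p1CubeRec a h U b₀ A W n = f0 n + f1 n + f2 n := fun n => rfl
  have hm0 : ∀ n, 0 ≤ p1OctW W n := fun n => by unfold p1OctW; exact le_max_of_le_left (le_max_of_le_left (hW (n, 2)))
  have h0 : ∀ n, 0 ≤ f0 n := fun n => mul_nonneg (by linarith [hW (n, 0)]) (Finset.sum_nonneg fun e _ => hS _ _)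
  have h1 : ∀ n, 0 ≤ f1 n := fun n => mul_nonneg (by linarith [hW (n, 1)]) (Finset.sum_nonneg fun e _ => hS _ _)
  have h2 : ∀ n, 0 ≤ f2 n := fun n => mul_nonneg (by linarith [hm0 n]) (Finset.sum_nonneg fun e _ => hS _ _)
  have hs0 : Summable f0 := Summable.of_nonneg_of_le h0 (fun n => by rw [hdec]; linarith [h1 n, h2 n]) hs
  have hs1 : Summable f1 := Summable.of_nonneg_of_le h1 (fun n => by rw [hdec]; linarith [h0 n, h2 n]) hs
  have hs2 : Summable f2 := Summable.of_nonneg_of_le h2 (fun n => by rw [hdec]; linarith [h0 n, h1 n]) hs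
  obtain ⟨hr0, e0⟩ := tsum_mul_sum_slots_eq (fun b => p1TetTail b 0) (fun b => p1TetHead b 0) (fun b i => p1TetTail_mem b 0 i)
    (fun b i => p1TetHead_mem b 0 i) (c := fun n => 4 * W (n, 0)) (fun n => by linarith [hW (n, 0)]) hS hs0
  obtain ⟨hr1, e1⟩ := tsum_mul_sum_slots_eq (fun b => p1TetTail b 1) (fun b => p1TetHead b 1) (fun b i => p1TetTail_mem b 1 i)
    (fun b i => p1TetHead_mem b 1 i) (c := fun n => 4 * W (n, 1)) (fun n => by linarith [hW (n, 1)]) hS hs1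
  obtain ⟨hr2, e2⟩ := tsum_mul_sum_slots_eq p1OctTail p1OctHead p1OctTail_mem p1OctHead_mem (c := fun n => 16 * p1OctW W n)
    (fun n => by linarith [hm0 n]) hS hs2
  have hpt : ∀ q, (∑ d ∈ p1BondOffsets, p1BondW W q d * S q (q + d)) =
      (∑ d ∈ p1BondOffsets, p1SlotW (fun b => p1TetTail b 0) (fun b => p1TetHead b 0) (fun n => 4 * W (n, 0)) q d * S q (q + d)) +
      (∑ d ∈ p1BondOffsets, p1SlotW (fun b => p1TetTail b 1) (fun b => p1TetHead b 1) (fun n => 4 * W (n, 1)) q d * S q (q + d)) +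
      (∑ d ∈ p1BondOffsets, p1SlotW p1OctTail p1OctHead (fun n => 16 * p1OctW W n) q d * S q (q + d)) := by
    intro q
    rw [← Finset.sum_add_distrib, ← Finset.sum_add_distrib]
    refine Finset.sum_congr rfl fun d _ => ?_
    unfold p1BondW
    ring
  refine ⟨((hr0.add hr1).add hr2).congr fun q => (hpt q).symm, ?_⟩
  calc ∑' n, p1CubeRec a h U b₀ A W n = ∑' n, (f0 n + f1 n + f2 n) := tsum_congr hdec
    _ = ∑' n, f0 n + ∑' n, f1 n + ∑' n, f2 n := by rw [(hs0.add hs1).tsum_add hs2, hs0.tsum_add hs1]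
    _ = _ := by rw [e0, e1, e2, ← hr0.tsum_add hr1, ← (hr0.add hr1).tsum_add hr2]; exact tsum_congr fun q => (hpt q).symm

end Summit.AtomisticToContinuum.Crystallization.Theorems.StrictSplittingRuleBirth
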